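import Mathlib
import Summits.Ventures.PercRepro.TriangleCapFourRowThreeCap

/-!
# PercRepro — THE CAP ON THE CELL `(k, 4, 4)`: a `K₄⁻`-free graph with `4 (k − 4) − 4` edges on `k ≥ 12` vertices
with a vertex of degree `k − 4` is `4`-bipartite or at least `4` below the closed form (p3, gen 46; part 199p)

The count of parts 198a / 199b with four missing pairs: `2K + 2M + 2P + E = 8K − 8`, `P + 3M ≤ 3K`, `E ≤ 6`, and an
edge inside `R` forcing `E ≤ 4 ∧ P + M ≤ 2K + 1` or `P + M ≤ 2K` (`four_three_noedge`) leave `E = 0` and `M ≤ 2`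
for `K ≥ 8`. `M = 0` is `D ⊆ K(N(x)ᶜ, N(x))`; `M = 1` has `P = 3K − 5` with the three non-neighbours at most
`K − 1, K − 1, K − 3` (`Σ_R d² ≤ 3K² − 10K + 11`, `four_four_R_arith`) and `Σ_N d² ≤ K + 12 + 5P`; `M = 2` has
`P = 3K − 6`, every `P_u ≤ K − 2` and `Σ_N d² ≤ K + 24 + 5P` (`2 Σ_N f g ≤ |R| · adjPairs N = 12`). Both close
below `m k − 4 (k − 5) − 4` (the one-triangle family `T` on `(k, 4, 4)` is `2k − 14` below; the bound `4` here is
what the second-best value of the cell needs). Axioms: standard.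
-/

namespace PercRepro

namespace TriangleCap

namespace C047

open Finset

variable {V : Type*} [Fintype V] [DecidableEq V]

/-- The count at the cap of the cell `(k, 4, 4)`, `K ≥ 8`: `E = 0` and `M ≤ 2`. -/
theorem four_four_cap_count (K M P E m : ℕ) (hdeg : K + (K + 2 * M + P) + (P + E) = 2 * m) (hm : m + 4 = 4 * K)
    (h2 : P + 3 * M ≤ 3 * K) (hE : E ≤ 6) (hK : 8 ≤ K)
    (hnoedge : 1 ≤ E → (E ≤ 4 ∧ P + M ≤ 2 * K + 1) ∨ P + M ≤ 2 * K) :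
    E = 0 ∧ M ≤ 2 := by
  by_cases hE1 : 1 ≤ E
  · rcases hnoedge hE1 with ⟨h1, h2'⟩ | h3 <;> omega
  · omega

/-- Three values `≤ K − 1` with sum `3K − 5` have `x² + y² + z² ≤ 3K² − 10K + 11`. -/
theorem four_four_R_arith (x y z K : ℕ) (hK : 8 ≤ K) (hx : x + 1 ≤ K) (hy : y + 1 ≤ K) (hz : z + 1 ≤ K)
    (hsum : x + y + z + 5 = 3 * K) : x * x + y * y + z * z + 10 * K ≤ 3 * (K * K) + 11 := by
  obtain ⟨t, rfl⟩ : ∃ t, K = t + 8 := ⟨K - 8, by omega⟩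
  obtain ⟨a, ha, rfl⟩ : ∃ a, a ≤ 2 ∧ x = t + 5 + a := ⟨x - (t + 5), by omega, by omega⟩
  obtain ⟨b, hb, rfl⟩ : ∃ b, b ≤ 2 ∧ y = t + 5 + b := ⟨y - (t + 5), by omega, by omega⟩
  obtain ⟨c, hc, rfl⟩ : ∃ c, c ≤ 2 ∧ z = t + 5 + c := ⟨z - (t + 5), by omega, by omega⟩
  have habc : a + b + c = 4 := by omega
  interval_cases a <;> interval_cases b <;> interval_cases c <;> nlinarith

/-- The arithmetic of `M = 1`: `P + 5 = 3K`, `S_N ≤ K + 12 + 5P`, `S_R + 10K ≤ 3K² + 11` ⇒ the target. -/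
theorem four_four_cap_sq_arith_one (K P SN SR m : ℕ) (hK : 8 ≤ K) (hm : m + 4 = 4 * K) (hP : P + 5 = 3 * K)
    (hSN : SN ≤ K + 12 + 5 * P) (hSR : SR + 10 * K ≤ 3 * (K * K) + 11) :
    K * K + SN + SR + 4 * (K + 4 - 5) + 4 ≤ m * (K + 4) := by
  obtain ⟨t, rfl⟩ : ∃ t, K = t + 8 := ⟨K - 8, by omega⟩
  have hP' : P = 3 * t + 19 := by omega
  have hm' : m = 4 * t + 28 := by omega
  subst hP' hm'
  have e1 : t + 8 + 4 - 5 = t + 7 := by omega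
  rw [e1]
  nlinarith [hSN, hSR]

/-- The arithmetic of `M = 2`: `P + 6 = 3K`, `S_N ≤ K + 24 + 5P`, `S_R ≤ (K − 2) P` ⇒ the target. -/
theorem four_four_cap_sq_arith_two (K P SN SR m : ℕ) (hK : 8 ≤ K) (hm : m + 4 = 4 * K) (hP : P + 6 = 3 * K)
    (hSN : SN ≤ K + 24 + 5 * P) (hSR : SR ≤ (K - 2) * P) :
    K * K + SN + SR + 4 * (K + 4 - 5) + 4 ≤ m * (K + 4) := by
  obtain ⟨t, rfl⟩ : ∃ t, K = t + 8 := ⟨K - 8, by omega⟩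
  have hP' : P = 3 * t + 18 := by omega
  have hm' : m = 4 * t + 28 := by omega
  subst hP' hm'
  have e1 : t + 8 + 4 - 5 = t + 7 := by omega
  have e2 : t + 8 - 2 = t + 6 := by omega
  rw [e1]
  rw [e2] at hSR
  nlinarith [hSN, hSR]

/-- **THE CAP ON THE CELL `(k, 4, 4)`, `k ≥ 12`:** a `K₄⁻`-free graph with `4 (k − 4) − 4` edges and a vertex `x` of
degree `k − 4` is a spanning subgraph of some `K(A, Aᶜ)` with `|A| = 4`, or `Σ_v d(v)² + 4 (k − 5) + 4 ≤ m k`. -/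
theorem four_four_cap (D : SimpleGraph V) [DecidableRel D.Adj] (hK : K4mFree D) (hk : 12 ≤ Fintype.card V)
    (hm : D.edgeFinset.card + 4 = 4 * (Fintype.card V - 4)) (x : V) (hx : deg D x + 4 = Fintype.card V) :
    (∃ A : Finset V, A.card = 4 ∧ BipSub D A) ∨
      ∑ v, deg D v * deg D v + 4 * (Fintype.card V - 5) + 4 ≤ D.edgeFinset.card * Fintype.card V := by
  obtain ⟨N, hN⟩ : ∃ N : Finset V, N = univ.filter (fun w => D.Adj x w) := ⟨_, rfl⟩
  have hmemN : ∀ w, w ∈ N ↔ D.Adj x w := fun w => by rw [hN, mem_filter]; simp only [mem_univ, true_and]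
  have hxN : x ∉ N := fun h => D.irrefl ((hmemN x).mp h)
  have hdx : deg D x = N.card := by rw [hN]; rfl
  obtain ⟨K, hKdef⟩ : ∃ K, N.card = K := ⟨_, rfl⟩
  have hcardV : Fintype.card V = K + 4 := by omega
  obtain ⟨m, hmdef⟩ : ∃ m, D.edgeFinset.card = m := ⟨_, rfl⟩
  rw [hmdef, hcardV, Nat.add_sub_cancel] at hm
  -- the non-neighbours `R`, `|R| = 3`
  obtain ⟨R, hR⟩ : ∃ R : Finset V, R = (insert x N)ᶜ := ⟨_, rfl⟩
  have hRcard : R.card = 3 := by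
    rw [hR, card_compl, card_insert_of_notMem hxN]
    omega
  have hmemR : ∀ w, w ∈ R ↔ w ≠ x ∧ ¬ D.Adj x w := by
    intro w
    rw [hR, mem_compl, mem_insert, hmemN]
    tauto
  -- the matching inside `N`
  obtain ⟨M, hM⟩ : ∃ M, adjPairs D N = 2 * M := ⟨_, adjPairs_eq_two_mul D N⟩
  have hTf : ∑ y ∈ N, degIn D N y = 2 * M := by rw [← adjPairs_eq_sum_degIn, hM]
  -- `P = Σ_{u ∈ R} degIn N u`, `E = adjPairs R`
  obtain ⟨P, hPdef⟩ : ∃ P, ∑ u ∈ R, degIn D N u = P := ⟨_, rfl⟩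
  obtain ⟨E, hEdef⟩ : ∃ E, adjPairs D R = E := ⟨_, rfl⟩
  -- the degree sum over `{x} ∪ N ∪ R`
  have hsplit : ∀ F : V → ℕ, ∑ w, F w = F x + ∑ y ∈ N, F y + ∑ u ∈ R, F u := by
    intro F
    rw [← sum_add_sum_compl (insert x N), sum_insert hxN, ← hR]
  have hdegN : ∀ y ∈ N, deg D y = 1 + degIn D N y + degIn D R y := by
    intro y hy
    have := deg_eq_of_mem_nbhd D x y ((hmemN y).mp hy)
    rw [← hN, ← hR] at this
    exact this
  have hsumN : ∑ y ∈ N, deg D y = K + 2 * M + P := by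
    rw [sum_congr rfl hdegN, sum_add_distrib, sum_add_distrib, sum_const, smul_eq_mul, mul_one, hKdef, hTf,
      sum_degIn_comm D N R, hPdef]
  have hdegR : ∀ u ∈ R, deg D u = degIn D N u + degIn D R u := by
    intro u hu
    have := deg_eq_of_not_mem_nbhd D x u ((hmemR u).mp hu).2
    rw [← hN, ← hR] at this
    exact this
  have hsumR : ∑ u ∈ R, deg D u = P + E := by
    rw [sum_congr rfl hdegR, sum_add_distrib, hPdef, ← adjPairs_eq_sum_degIn, hEdef]
  have hdegsum := sum_deg_eq D
  rw [hsplit, hsumN, hsumR, hdx, hKdef, hmdef] at hdegsum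
  -- (2) every vertex of `R` has at most `K − M` neighbours in `N` (one end of each matching edge)
  have hPle : ∀ u ∈ R, degIn D N u + M ≤ K := by
    intro u hu
    have := two_mul_degIn_add_adjPairs_le D hK (x := x) ((hmemR u).mp hu).1
    rw [← hN, hM, hKdef] at this
    omega
  have h2 : P + 3 * M ≤ 3 * K := by
    have hs : ∑ u ∈ R, (degIn D N u + M) ≤ ∑ _u ∈ R, K := sum_le_sum hPle
    rw [sum_add_distrib, sum_const, sum_const, smul_eq_mul, smul_eq_mul, hPdef, hRcard] at hs
    exact hs
  -- (3) `E ≤ 6`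
  have hE6 : E ≤ 6 := by
    have := adjPairs_le_card_mul_pred D R
    rw [hEdef, hRcard] at this
    exact this
  -- (4) an edge inside `R` is impossible
  have hnoedge : 1 ≤ E → (E ≤ 4 ∧ P + M ≤ 2 * K + 1) ∨ P + M ≤ 2 * K := by
    intro hE
    have := four_three_noedge D hK x N R hmemN hmemR hRcard K M hKdef hPle (by rw [hEdef]; exact hE)
    rw [hEdef, hPdef] at this
    exact this
  -- (5) `E = 0`, `M ≤ 1`
  obtain ⟨hE0, hM2⟩ := four_four_cap_count K M P E m hdegsum hm h2 hE6 (by omega) hnoedge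
  -- no edge inside `R`
  have hnoR : ∀ u ∈ R, degIn D R u = 0 := by
    intro u hu
    have hle : degIn D R u ≤ ∑ z ∈ R, degIn D R z := single_le_sum (fun _ _ => Nat.zero_le _) hu
    rw [← adjPairs_eq_sum_degIn, hEdef, hE0] at hle
    exact Nat.le_zero.mp hle
  rcases Nat.eq_zero_or_pos M with hM0 | hMpos
  · -- `M = 0`: no edge inside `N`, none inside `R`: `D ⊆ K(Nᶜ, N)`
    left
    have hnoN : ∀ y ∈ N, ∀ y', D.Adj y y' → y' ∉ N := by
      intro y hy y' hyy' hy'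
      have h0 : degIn D N y = 0 := by
        have hle : degIn D N y ≤ ∑ z ∈ N, degIn D N z := single_le_sum (fun _ _ => Nat.zero_le _) hy
        rw [hTf, hM0, mul_zero] at hle
        exact Nat.le_zero.mp hle
      unfold degIn at h0
      rw [card_eq_zero, filter_eq_empty_iff] at h0
      exact h0 hy' hyy'
    have hnoR' : ∀ u ∈ R, ∀ u', D.Adj u u' → u' ∉ R := by
      intro u hu u' huu' hu'
      have h0 := hnoR u hu
      unfold degIn at h0
      rw [card_eq_zero, filter_eq_empty_iff] at h0
      exact h0 hu' huu'
    refine ⟨Nᶜ, ?_, ?_⟩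
    · rw [card_compl, hKdef]
      omega
    · intro p q hpq
      rw [mem_compl, mem_compl, not_not]
      constructor
      · intro hpN
        by_contra hqN
        by_cases hpx : p = x
        · subst hpx
          exact hqN ((hmemN q).mpr hpq)
        by_cases hqx : q = x
        · subst hqx
          exact hpN ((hmemN p).mpr (D.adj_symm hpq))
        have hpR : p ∈ R := (hmemR p).mpr ⟨hpx, fun h => hpN ((hmemN p).mpr h)⟩
        have hqR : q ∈ R := (hmemR q).mpr ⟨hqx, fun h => hqN ((hmemN q).mpr h)⟩
        exact hnoR' p hpR q hpq hqR
      · intro hqN hpN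
        exact hnoN p hpN q hpq hqN
  · -- `M ∈ {1, 2}`
    right
    -- `Σ_N d²`: the general bound `K + 3 · 2M + 5P + 2 Σ f g`
    have hgle : ∀ y ∈ N, degIn D R y ≤ 3 := fun y _ => by
      have := degIn_le_card D R y
      rw [hRcard] at this
      exact this
    have hSN : ∑ y ∈ N, deg D y * deg D y ≤ K + 3 * (2 * M) + 5 * P +
        2 * ∑ y ∈ N, degIn D N y * degIn D R y := by
      have h : ∀ y ∈ N, deg D y * deg D y ≤
          1 + 3 * degIn D N y + 5 * degIn D R y + 2 * (degIn D N y * degIn D R y) := by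
        intro y hy
        rw [hdegN y hy]
        apply cap_sq_bound
        · have h1 := degIn_nbhd_le_one D hK (x := x) (u := y) ((hmemN y).mp hy)
          rw [← hN] at h1
          exact h1
        · exact hgle y hy
      calc ∑ y ∈ N, deg D y * deg D y
          ≤ ∑ y ∈ N, (1 + 3 * degIn D N y + 5 * degIn D R y + 2 * (degIn D N y * degIn D R y)) := sum_le_sum h
        _ = N.card + 3 * ∑ y ∈ N, degIn D N y + 5 * ∑ y ∈ N, degIn D R y +
            2 * ∑ y ∈ N, degIn D N y * degIn D R y := by
          rw [sum_add_distrib, sum_add_distrib, sum_add_distrib, sum_const, smul_eq_mul, mul_one, mul_sum,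
            mul_sum, mul_sum]
        _ = K + 3 * (2 * M) + 5 * P + 2 * ∑ y ∈ N, degIn D N y * degIn D R y := by
          rw [hKdef, hTf, sum_degIn_comm D N R, hPdef]
    have hfg : 2 * ∑ y ∈ N, degIn D N y * degIn D R y ≤ 3 * (2 * M) := by
      have := two_mul_sum_degIn_mul_degIn_le D hK x R (fun u hu => ((hmemR u).mp hu).1)
      rw [← hN, hM, hRcard] at this
      exact this
    have hdegRu : ∀ u ∈ R, deg D u = degIn D N u := fun u hu => by
      rw [hdegR u hu, hnoR u hu, add_zero]
    rw [hsplit (fun v => deg D v * deg D v), hdx, hKdef, hmdef, hcardV]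
    rw [hE0] at hdegsum
    rcases Nat.lt_or_ge M 2 with hM1 | hM2'
    · -- `M = 1`: `P = 3K − 5`, the exact `R`-sum
      have hM1' : M = 1 := by omega
      subst hM1'
      have hP : P + 5 = 3 * K := by omega
      have hSR : ∑ u ∈ R, deg D u * deg D u + 10 * K ≤ 3 * (K * K) + 11 := by
        obtain ⟨u, v, w, huv, huw, hvw, hR3⟩ := card_eq_three.mp hRcard
        have hsum3 : ∀ f : V → ℕ, ∑ t ∈ R, f t = f u + f v + f w := by
          intro f
          rw [hR3, sum_insert, sum_insert, sum_singleton, add_assoc]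
          · rw [mem_singleton]; exact hvw
          · rw [mem_insert, mem_singleton]; push Not; exact ⟨huv, huw⟩
        have hmemR3 : ∀ t, t ∈ R ↔ t = u ∨ t = v ∨ t = w := by
          intro t
          rw [hR3, mem_insert, mem_insert, mem_singleton]
        have hu : u ∈ R := (hmemR3 u).mpr (Or.inl rfl)
        have hv : v ∈ R := (hmemR3 v).mpr (Or.inr (Or.inl rfl))
        have hw : w ∈ R := (hmemR3 w).mpr (Or.inr (Or.inr rfl))
        have hsumP : degIn D N u + degIn D N v + degIn D N w + 5 = 3 * K := by
          rw [← hsum3, hPdef]; exact hP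
        rw [hsum3, hdegRu u hu, hdegRu v hv, hdegRu w hw]
        exact four_four_R_arith _ _ _ K (by omega) (hPle u hu) (hPle v hv) (hPle w hw) hsumP
      exact four_four_cap_sq_arith_one K P _ _ m (by omega) hm hP (by omega) hSR
    · -- `M = 2`: `P = 3K − 6`, every `P_u ≤ K − 2`
      have hM2' : M = 2 := by omega
      subst hM2'
      have hP : P + 6 = 3 * K := by omega
      have hSR : ∑ u ∈ R, deg D u * deg D u ≤ (K - 2) * P := by
        have h : ∀ u ∈ R, deg D u * deg D u ≤ (K - 2) * degIn D N u := by
          intro u hu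
          have hle : degIn D N u ≤ K - 2 := by have := hPle u hu; omega
          rw [hdegRu u hu]
          exact Nat.mul_le_mul_right _ hle
        calc ∑ u ∈ R, deg D u * deg D u ≤ ∑ u ∈ R, (K - 2) * degIn D N u := sum_le_sum h
          _ = (K - 2) * P := by rw [← mul_sum, hPdef]
      exact four_four_cap_sq_arith_two K P _ _ m (by omega) hm hP (by omega) hSR

end C047

end TriangleCap

end PercRepro
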